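import Mathlib
import Summits.Ventures.PercRepro2.SwOutFrozenBaseG

/-!
# THE FROZEN BASE, II: the antipode, the block inequality, and the frozen base with routed
decorations — the avoidance lemmas from the outside (blind cell PercRepro2, night-4 g38,
2026-08-29; proofs/NIGHT4-G38.md §2–§3)

At the ANTIPODE `flipAll ω` the red cluster of `h` lies in `R ∪ armsFalseC ω` and every red edge
inside that set toggles between `ω` and its antipode (a coordinate or an edge touching a unit — a
frozen root–root edge is blue everywhere), so the red edges of `h` at the antipode are blue edges of
`h` at `ω` (`redEdges_flipAll_subset_blueEdges` — hswap of g36's weak cube principle) at EVERY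
point; with the injectivity and the monotone red edge set of SwOutFrozenBaseG:
**`FrozenBaseG.card_decoCubeRR_le_of_lowerSet`**, the rigid counting inequality on the block for
every conditioning that pulls back to a lower set.

`FrozenDecoG` adds g35's blue route of the decorations, the decoration edges (to the arm, the
decoration, `l`, or to a BYSTANDER — an outside vertex in no unit — by an edge blue at the base)
and the frozen part's red edges to the outside: the avoidance lemmas from the outside, the blue
cluster of a root, the hull of a root inside `H`.  The hinge: SwOutFrozenBaseGHinge.
-/

namespace Summit.Ventures.PercRepro2

namespace LocRows

open Hull

universe u v

variable {V : Type u} {E : Type v}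

open scoped Classical

variable {ends : E → Sym2 V}

section Mono

variable {ι : Type*} {A Z : ι → Set V} {ζ : Config E} {R H : Set V} {l : V} {RR : Finset E}
  {Fz : Set V} (hb : FrozenBaseG ends ζ R H l A Z RR Fz)
include hb

/-! ### The antipode -/

/-- The flipped cube point negates every edge touching a unit or joining two roots. -/
lemma FrozenBaseG.decoRealRR_flipAll_apply {ω : Config (ι ⊕ ↥RR)} {e : E}
    (he : e ∈ touches ends (allArms (unitAZ A Z)) ∨ e ∈ RR) :
    decoRealRR ends A Z RR ζ (flipAll ω) e = !decoRealRR ends A Z RR ζ ω e := by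
  by_cases hrr : e ∈ RR
  · rw [decoRealRR_apply_rr hrr, decoRealRR_apply_rr hrr]
    by_cases hi : ω (Sum.inr ⟨e, hrr⟩) = true
    · have : flipAll ω (Sum.inr ⟨e, hrr⟩) ≠ true := by simp [flipAll, hi]
      rw [if_neg this, if_pos hi]
    · have : flipAll ω (Sum.inr ⟨e, hrr⟩) = true := by simp [flipAll]; simpa using hi
      rw [if_pos this, if_neg hi, Bool.not_not]
  · have ht : e ∈ touches ends (allArms (unitAZ A Z)) := by
      rcases he with he | he
      · exact he
      · exact absurd he hrr
    obtain ⟨i, x, y, hxy, hx⟩ := DecoBaseE.exists_unit_of_touches ht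
    rw [hb.decoRealRR_apply_of_mem hxy hx, hb.decoRealRR_apply_of_mem hxy hx]
    by_cases hi : ω (Sum.inl i) = true
    · have : flipAll ω (Sum.inl i) ≠ true := by simp [flipAll, hi]
      rw [if_neg this, if_pos hi]
    · have : flipAll ω (Sum.inl i) = true := by simp [flipAll]; simpa using hi
      rw [if_pos this, if_neg hi, Bool.not_not]

/-- An edge inside `R ∪ allArms` that is red at some cube point touches a unit or is a root–root
coordinate (a frozen root–root edge is blue everywhere). -/
lemma FrozenBaseG.touches_or_rr_of_within_arms {ω : Config (ι ⊕ ↥RR)} {e : E}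
    (he : e ∈ within ends (R ∪ allArms A)) (hred : decoRealRR ends A Z RR ζ ω e = true) :
    e ∈ touches ends (allArms (unitAZ A Z)) ∨ e ∈ RR := by
  obtain ⟨x, hx, y, hy, hxy⟩ := he
  rcases hx with hxR | ⟨i, hi⟩
  · rcases hy with hyR | ⟨j, hj⟩
    · by_contra h'
      have hrr : e ∉ RR := fun h'' => h' (Or.inr h'')
      rw [hb.decoRealRR_rr_frozen_edge hxR hyR hxy hrr] at hred
      exact absurd hred (by decide)
    · exact Or.inl ⟨y, ⟨j, Or.inl hj⟩, x, ends_swap hxy⟩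
  · exact Or.inl ⟨x, ⟨i, Or.inl hi⟩, y, hxy⟩

omit hb in
/-- The arms assigned `true` by the antipode are the arms assigned `false`. -/
lemma FrozenBaseG.armsTrueC_flipAll (ω : Config (ι ⊕ ↥RR)) :
    armsTrueC A (armPart (flipAll ω)) = armsFalseC A (armPart ω) := by
  ext x; simp [armsFalseC, armsTrueC, armPart, flipAll]

/-- **The red cluster of a root at the antipode lies in its blue cluster at the point.** -/
theorem FrozenBaseG.cluster_flipAll_subset_cluster_blue {r : V} (hr : r ∈ R)
    (ω : Config (ι ⊕ ↥RR)) :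
    cluster ends (decoRealRR ends A Z RR ζ (flipAll ω)) r ⊆
      cluster ends (blue (decoRealRR ends A Z RR ζ ω)) r := by
  refine cluster_subset_of_le_within (S := R ∪ armsTrueC A (armPart (flipAll ω)))
    (fun _ hx _ hxy => hb.red_closed (flipAll ω) hx hxy) (Or.inl hr) ?_
  intro e he hred
  have hsub : within ends (R ∪ armsTrueC A (armPart (flipAll ω))) ⊆ within ends (R ∪ allArms A) :=
    within_mono (fun z hz => by
      rcases hz with hz | ⟨i, -, hz⟩
      · exact Or.inl hz
      · exact Or.inr ⟨i, hz⟩)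
  rw [blue_apply, ← hb.decoRealRR_flipAll_apply (hb.touches_or_rr_of_within_arms (hsub he) hred)]
  exact hred

/-- **The red edges of `h` at the antipode are blue edges of `h` at the point.** -/
theorem FrozenBaseG.redEdges_flipAll_subset_blueEdges {h : V} (hh : h ∈ R)
    (ω : Config (ι ⊕ ↥RR)) :
    redEdges ends (decoRealRR ends A Z RR ζ (flipAll ω)) h ⊆
      blueEdges ends (decoRealRR ends A Z RR ζ ω) h := by
  rintro e ⟨he, hw⟩
  refine ⟨?_, within_mono (hb.cluster_flipAll_subset_cluster_blue hh ω) hw⟩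
  have hsub : within ends (cluster ends (decoRealRR ends A Z RR ζ (flipAll ω)) h) ⊆
      within ends (R ∪ allArms A) :=
    (hb.within_cluster_subset hh (flipAll ω)).trans (within_mono (fun z hz => by
      rcases hz with hz | ⟨i, -, hz⟩
      · exact Or.inl hz
      · exact Or.inr ⟨i, hz⟩))
  rw [blue_apply, ← hb.decoRealRR_flipAll_apply (hb.touches_or_rr_of_within_arms (hsub hw) he)]
  exact he

/-! ### The block inequality -/

/-- **THE BLOCK INEQUALITY OF A FROZEN BASE**: for every conditioning `Qs` that pulls back to a
lower set of the cube, the rigid counting inequality holds on the block `decoCubeRR` of a frozen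
base — the weak cube principle with the monotone red edge set and the antipode containment of
this file and the injectivity of the realisation. -/
theorem FrozenBaseG.card_decoCubeRR_le_of_lowerSet [Fintype E] [DecidableEq E] [Fintype ι]
    {h : V} (hh : h ∈ R) (Qs : Set (Config E))
    (hEv : IsLowerSet {ω | decoRealRR ends A Z RR ζ ω ∈ Qs})
    {𝓔 : Set (Set E)} (h𝓔 : IsUpperSet 𝓔) :
    ((decoCubeRR ends A Z RR ζ).filter fun ζ' => ζ' ∈ Qs ∧ redEdges ends ζ' h ∈ 𝓔).card ≤
      ((decoCubeRR ends A Z RR ζ).filter fun ζ' => ζ' ∈ Qs ∧ blueEdges ends ζ' h ∈ 𝓔).card :=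
  card_le_of_cube_edges_weak (ends := ends) (decoRealRR ends A Z RR ζ) hb.decoRealRR_injective
    (decoCubeRR ends A Z RR ζ) (fun _ => mem_decoCubeRR) Qs hEv h
    (fun _ h𝓔' _ _ hω hω𝓔 => h𝓔' (hb.redEdges_decoRealRR_mono hh hω) hω𝓔)
    (fun ω _ => hb.redEdges_flipAll_subset_blueEdges hh ω) h𝓔


end Mono

/-! ## §3 The hinge -/

/-- **A frozen base with routed decorations**: the edges at a decoration vertex go to its arm, its
decoration, `l`, or (blue at the base) to a bystander — an outside vertex in no unit; every
decoration vertex is blue-connected to `l` by blue edges touching its unit; the frozen part's edges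
to the outside of `H` are red. -/
structure FrozenDecoG (ends : E → Sym2 V) (ζ : Config E) (R : Set V) (H : Set V) (l : V)
    {ι : Type*} (A Z : ι → Set V) (RR : Finset E) (Fz : Set V) : Prop where
  base : FrozenBaseG ends ζ R H l A Z RR Fz
  deco_edges : ∀ i, ∀ e z y, ends e = s(z, y) → z ∈ Z i →
    y ∈ A i ∨ y ∈ Z i ∨ y = l ∨ (y ∉ H ∧ (∀ j, y ∉ unitAZ A Z j) ∧ ζ e = false)
  deco_conn : ∀ i, ∀ z ∈ Z i, z ∈ cluster ends (decoRoute ends (A i ∪ Z i) ζ) l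
  fz_bdry_red : ∀ e x y, ends e = s(x, y) → x ∈ Fz → y ∉ H → ζ e = true


section Hinge

variable {ι : Type*} {A Z : ι → Set V} {ζ : Config E} {R H : Set V} {l : V} {RR : Finset E}
  {Fz : Set V} (hd : FrozenDecoG ends ζ R H l A Z RR Fz)
include hd

/-! ### The routes -/

/-- The route configuration of a unit assigned `false` lies below the realisation. -/
lemma FrozenDecoG.decoRoute_le_decoRealRR {ω : Config (ι ⊕ ↥RR)} {i : ι}
    (hi : ω (Sum.inl i) = false) :
    decoRoute ends (unitAZ A Z i) ζ ≤ decoRealRR ends A Z RR ζ ω := by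
  intro e
  by_cases he : decoRoute ends (unitAZ A Z i) ζ e = true
  · rw [he]
    obtain ⟨hζe, x, hx, y, hxy⟩ := decoRoute_eq_true_iff.1 he
    rw [hd.base.decoRealRR_apply_of_mem hxy hx, if_neg (by simp [hi]), hζe]
    exact le_refl _
  · simp only [Bool.not_eq_true] at he
    rw [he]; exact Bool.false_le _

/-- The route configuration of a unit assigned `true` lies below the blue realisation. -/
lemma FrozenDecoG.decoRoute_le_blue_decoRealRR {ω : Config (ι ⊕ ↥RR)} {i : ι}
    (hi : ω (Sum.inl i) = true) :
    decoRoute ends (unitAZ A Z i) ζ ≤ blue (decoRealRR ends A Z RR ζ ω) := by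
  intro e
  by_cases he : decoRoute ends (unitAZ A Z i) ζ e = true
  · rw [he]
    obtain ⟨hζe, x, hx, y, hxy⟩ := decoRoute_eq_true_iff.1 he
    rw [blue_apply, hd.base.decoRealRR_apply_of_mem hxy hx, if_pos hi, hζe]
    exact le_refl _
  · simp only [Bool.not_eq_true] at he
    rw [he]; exact Bool.false_le _

/-- **A decoration vertex of a unit assigned `false` lies in the red cluster of `l`.** -/
theorem FrozenDecoG.deco_mem_cluster_l_of_false {ω : Config (ι ⊕ ↥RR)} {i : ι}
    (hi : ω (Sum.inl i) = false) {z : V} (hz : z ∈ Z i) :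
    z ∈ cluster ends (decoRealRR ends A Z RR ζ ω) l :=
  cluster_mono (hd.decoRoute_le_decoRealRR hi) l (hd.deco_conn i z hz)

/-- **A decoration vertex of a unit assigned `true` lies in the blue cluster of `l`.** -/
theorem FrozenDecoG.deco_mem_cluster_blue_l_of_true {ω : Config (ι ⊕ ↥RR)} {i : ι}
    (hi : ω (Sum.inl i) = true) {z : V} (hz : z ∈ Z i) :
    z ∈ cluster ends (blue (decoRealRR ends A Z RR ζ ω)) l :=
  cluster_mono (hd.decoRoute_le_blue_decoRealRR hi) l (hd.deco_conn i z hz)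

/-! ### The avoidance lemmas from the outside -/

/-- An outside vertex is adjacent to no root. -/
lemma FrozenDecoG.notMem_H_of_adj_root {e : E} {r x : V} (hr : r ∈ R) (hrx : ends e = s(r, x)) :
    x ∈ H := by
  rcases hd.base.root_edges e r x hr hrx with hx | ⟨i, hx⟩ | hx
  · exact hd.base.root_sub hx
  · exact (hd.base.arm_sub i x hx).1
  · exact hd.base.fz_sub hx

/-- An edge between a frozen vertex and a vertex outside `H` is red at every cube point. -/
lemma FrozenDecoG.decoRealRR_fz_out_edge {ω : Config (ι ⊕ ↥RR)} {e : E} {x y : V}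
    (hxy : ends e = s(x, y)) (hx : x ∈ Fz) (hy : y ∉ H) :
    decoRealRR ends A Z RR ζ ω e = true := by
  rw [DecoBaseE.decoRealRR_apply_of_notMem]
  · exact hd.fz_bdry_red e x y hxy hx hy
  · rintro ⟨z, ⟨i, hz⟩, w, hzw⟩
    rw [hxy, Sym2.eq_iff] at hzw
    rcases hzw with ⟨rfl, -⟩ | ⟨-, rfl⟩
    · exact hd.base.fz_notMem_unit hx i hz
    · rcases hz with hz | hz
      · exact hy (hd.base.arm_sub i y hz).1
      · rcases hd.deco_edges i e y x (ends_swap hxy) hz with h' | h' | h' | ⟨h', -, -⟩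
        · exact (hd.base.arm_sub i x h').2.2 hx
        · exact hd.base.deco_notMem i x h' (hd.base.fz_sub hx)
        · exact hd.base.l_notMem (h' ▸ hd.base.fz_sub hx)
        · exact h' (hd.base.fz_sub hx)
  · exact hd.base.notMem_rr_of_notMem_R hxy (hd.base.fz_notMem_root x hx)

/-- A vertex outside `H`, in a `false` arm or frozen is no root. -/
lemma FrozenDecoG.notMem_R_of_mem_out_false {ω : Config ι} {z : V}
    (hz : z ∈ Hᶜ ∪ armsFalseC A ω ∪ Fz) : z ∉ R := by
  rintro hzR
  rcases hz with (hz | ⟨i, -, hz⟩) | hz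
  · exact hz (hd.base.root_sub hzR)
  · exact hd.base.root_notMem_arm hzR i hz
  · exact hd.base.fz_notMem_root z hz hzR

/-- A vertex outside `H` or in a `true` arm is no root. -/
lemma FrozenDecoG.notMem_R_of_mem_out_true {ω : Config ι} {z : V}
    (hz : z ∈ Hᶜ ∪ armsTrueC A ω) : z ∉ R := by
  rintro hzR
  rcases hz with hz | ⟨i, -, hz⟩
  · exact hz (hd.base.root_sub hzR)
  · exact hd.base.root_notMem_arm hzR i hz

/-- **Red paths from the outside visit outside vertices, `false` arms and the frozen part only**
(never a root, never a `true` arm). -/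
lemma FrozenDecoG.red_closed_out (ω : Config (ι ⊕ ↥RR)) {x y : V}
    (hx : x ∈ Hᶜ ∪ armsFalseC A (armPart ω) ∪ Fz)
    (hxy : (openGraph ends (decoRealRR ends A Z RR ζ ω)).Adj x y) :
    y ∈ Hᶜ ∪ armsFalseC A (armPart ω) ∪ Fz := by
  obtain ⟨_, e, he, hxy⟩ := exists_edge_of_adj hxy
  by_cases hyH : y ∈ H
  · by_cases hyR : y ∈ R
    · exfalso
      rcases hx with (hx | ⟨i, hi, hx⟩) | hx
      · exact hx (hd.notMem_H_of_adj_root hyR (ends_swap hxy))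
      · have := hd.base.decoRealRR_root_edge (ω := ω) hyR (ends_swap hxy) hx
        simp only [armPart] at hi
        rw [this.1 he] at hi; exact absurd hi (by decide)
      · rw [hd.base.decoRealRR_root_fz_edge hyR (ends_swap hxy) hx] at he
        exact absurd he (by decide)
    by_cases hyF : y ∈ Fz
    · exact Or.inr hyF
    obtain ⟨j, hy⟩ := hd.base.arm_cover y hyH hyR hyF
    rcases hx with (hx | ⟨i, hi, hx⟩) | hx
    · have := (hd.base.decoRealRR_out_edge (ends_swap hxy) hy hx).1 he
      exact Or.inl (Or.inr ⟨j, by simpa [armPart] using this, hy⟩)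
    · have hij : i = j := hd.base.unit_eq_of_edge hxy (Or.inl hx) (Or.inl hy)
      subst hij
      exact Or.inl (Or.inr ⟨i, hi, hy⟩)
    · exact absurd hx (hd.base.no_arm_fz e y x (ends_swap hxy) ⟨j, hy⟩)
  · exact Or.inl (Or.inl hyH)

/-- **Blue paths from the outside visit outside vertices and `true` arms only** (never a root,
never the frozen part). -/
lemma FrozenDecoG.blue_closed_out (ω : Config (ι ⊕ ↥RR)) {x y : V}
    (hx : x ∈ Hᶜ ∪ armsTrueC A (armPart ω))
    (hxy : (openGraph ends (blue (decoRealRR ends A Z RR ζ ω))).Adj x y) :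
    y ∈ Hᶜ ∪ armsTrueC A (armPart ω) := by
  obtain ⟨_, e, he, hxy⟩ := exists_edge_of_adj hxy
  rw [blue_eq_true_iff] at he
  by_cases hyH : y ∈ H
  · by_cases hyR : y ∈ R
    · exfalso
      rcases hx with hx | ⟨i, hi, hx⟩
      · exact hx (hd.notMem_H_of_adj_root hyR (ends_swap hxy))
      · have := hd.base.decoRealRR_root_edge (ω := ω) hyR (ends_swap hxy) hx
        simp only [armPart] at hi
        rw [this.2 hi] at he; exact absurd he (by decide)
    by_cases hyF : y ∈ Fz
    · exfalso
      rcases hx with hx | ⟨i, -, hx⟩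
      · rw [hd.decoRealRR_fz_out_edge (ends_swap hxy) hyF hx] at he
        exact absurd he (by decide)
      · exact hd.base.no_arm_fz e x y hxy ⟨i, hx⟩ hyF
    obtain ⟨j, hy⟩ := hd.base.arm_cover y hyH hyR hyF
    rcases hx with hx | ⟨i, hi, hx⟩
    · have := hd.base.decoRealRR_out_edge (ω := ω) (ends_swap hxy) hy hx
      refine Or.inr ⟨j, ?_, hy⟩
      simp only [armPart]
      by_contra h'
      rw [Bool.not_eq_true] at h'
      rw [this.2 h'] at he; exact absurd he (by decide)
    · have hij : i = j := hd.base.unit_eq_of_edge hxy (Or.inl hx) (Or.inl hy)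
      subst hij
      exact Or.inr ⟨i, hi, hy⟩
  · exact Or.inl hyH

/-- A vertex of the red cluster of an outside vertex is outside `H`, in a `false` arm, or
frozen. -/
theorem FrozenDecoG.mem_out_false_or_fz_of_mem_cluster_out (ω : Config (ι ⊕ ↥RR)) {y x : V}
    (hy : y ∉ H) (hx : x ∈ cluster ends (decoRealRR ends A Z RR ζ ω) y) :
    x ∈ Hᶜ ∪ armsFalseC A (armPart ω) ∪ Fz :=
  mem_of_conn_of_closed (S := Hᶜ ∪ armsFalseC A (armPart ω) ∪ Fz)
    (fun _ hx' _ hxy => hd.red_closed_out ω hx' hxy) (Or.inl (Or.inl hy)) hx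

/-- A vertex of the blue cluster of an outside vertex is outside `H` or lies in a `true` arm. -/
theorem FrozenDecoG.mem_out_true_of_mem_cluster_blue_out (ω : Config (ι ⊕ ↥RR)) {y x : V}
    (hy : y ∉ H) (hx : x ∈ cluster ends (blue (decoRealRR ends A Z RR ζ ω)) y) :
    x ∈ Hᶜ ∪ armsTrueC A (armPart ω) :=
  mem_of_conn_of_closed (S := Hᶜ ∪ armsTrueC A (armPart ω))
    (fun _ hx' _ hxy => hd.blue_closed_out ω hx' hxy) (Or.inl hy) hx

/-- **A root is in neither cluster of an outside vertex at a cube point.** -/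
theorem FrozenDecoG.root_notMem_cluster_out (ω : Config (ι ⊕ ↥RR)) {y r : V} (hy : y ∉ H)
    (hr : r ∈ R) :
    r ∉ cluster ends (decoRealRR ends A Z RR ζ ω) y ∧
      r ∉ cluster ends (blue (decoRealRR ends A Z RR ζ ω)) y :=
  ⟨fun hr' => hd.notMem_R_of_mem_out_false (hd.mem_out_false_or_fz_of_mem_cluster_out ω hy hr') hr,
    fun hr' => hd.notMem_R_of_mem_out_true (hd.mem_out_true_of_mem_cluster_blue_out ω hy hr') hr⟩

/-! ### The blue cluster of a root -/

/-- **Blue paths from a root visit roots, `false` arms and the frozen part only.** -/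
lemma FrozenDecoG.blue_closed (ω : Config (ι ⊕ ↥RR)) {x y : V}
    (hx : x ∈ R ∪ armsFalseC A (armPart ω) ∪ Fz)
    (hxy : (openGraph ends (blue (decoRealRR ends A Z RR ζ ω))).Adj x y) :
    y ∈ R ∪ armsFalseC A (armPart ω) ∪ Fz := by
  obtain ⟨_, e, he, hxy⟩ := exists_edge_of_adj hxy
  rw [blue_eq_true_iff] at he
  rcases hx with (hx | ⟨i, hi, hx⟩) | hx
  · rcases hd.base.root_edges e x y hx hxy with hy | ⟨j, hy⟩ | hy
    · exact Or.inl (Or.inl hy)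
    · refine Or.inl (Or.inr ⟨j, ?_, hy⟩)
      have := hd.base.decoRealRR_root_edge (ω := ω) hx hxy hy
      simp only [armPart]
      by_contra h'
      rw [Bool.not_eq_false] at h'
      rw [this.2 h'] at he; exact absurd he (by decide)
    · exact Or.inr hy
  · by_cases hyR : y ∈ R
    · exact Or.inl (Or.inl hyR)
    by_cases hyH : y ∈ H
    · have hyF : y ∉ Fz := hd.base.no_arm_fz e x y hxy ⟨i, hx⟩
      obtain ⟨j, hy⟩ := hd.base.arm_cover y hyH hyR hyF
      have hij : i = j := hd.base.unit_eq_of_edge hxy (Or.inl hx) (Or.inl hy)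
      subst hij
      exact Or.inl (Or.inr ⟨i, hi, hy⟩)
    · exfalso
      have := hd.base.decoRealRR_out_edge (ω := ω) hxy hx hyH
      simp only [armPart] at hi
      rw [this.2 hi] at he; exact absurd he (by decide)
  · by_cases hyH : y ∈ H
    · by_cases hyR : y ∈ R
      · exact Or.inl (Or.inl hyR)
      by_cases hyF : y ∈ Fz
      · exact Or.inr hyF
      obtain ⟨j, hy⟩ := hd.base.arm_cover y hyH hyR hyF
      exact absurd hx (hd.base.no_arm_fz e y x (ends_swap hxy) ⟨j, hy⟩)
    · exfalso
      rw [hd.decoRealRR_fz_out_edge hxy hx hyH] at he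
      exact absurd he (by decide)

/-- A vertex of the blue cluster of a root is a root, lies in a `false` arm, or is frozen. -/
theorem FrozenDecoG.mem_root_or_false_or_fz_of_mem_cluster_blue (ω : Config (ι ⊕ ↥RR)) {r x : V}
    (hr : r ∈ R) (hx : x ∈ cluster ends (blue (decoRealRR ends A Z RR ζ ω)) r) :
    x ∈ R ∪ armsFalseC A (armPart ω) ∪ Fz :=
  mem_of_conn_of_closed (S := R ∪ armsFalseC A (armPart ω) ∪ Fz)
    (fun _ hx' _ hxy => hd.blue_closed ω hx' hxy) (Or.inl (Or.inl hr)) hx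

/-- **The hull of a root at a cube point lies inside `H`.** -/
theorem FrozenDecoG.hull_subset (ω : Config (ι ⊕ ↥RR)) {r : V} (hr : r ∈ R) :
    hull ends (decoRealRR ends A Z RR ζ ω) r ⊆ H := by
  rintro x (hx | hx)
  · exact hd.base.cluster_subset_H ω hr hx
  · rcases hd.mem_root_or_false_or_fz_of_mem_cluster_blue ω hr hx with (h' | ⟨i, -, hi⟩) | h'
    · exact hd.base.root_sub h'
    · exact (hd.base.arm_sub i x hi).1
    · exact hd.base.fz_sub h'


end Hinge

end LocRows

end Summit.Ventures.PercRepro2
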